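import Mathlib.Analysis.CStarAlgebra.Matrix
import Mathlib.Data.Fin.Tuple.Basic
import Mathlib.LinearAlgebra.Matrix.Notation
import Literature.Computability.QuantumComplexity.ForrelationComplete
import Literature.Computability.Cryptography.SamplingProblems
import Literature.Computability.Cryptography.QuantumCircuitProofs
import HarnessLib

/-!
# Aaronson–Ambainis, `PromiseBQP`-completeness of explicit `k`-fold Forrelation: the steps

Topic `Literature/Computability/QuantumComplexity`; sibling of `ForrelationComplete.lean`, whose
named fact `aaronson_ambainis_kForrelation_complete` (explicit `k`-fold Forrelation,
`kForrelationProblem`, is in `PromiseBQP` and `PromiseBQP`-hard under Karp reductions) is an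
XL statement over the tree's `TM2`-uniform Clifford+`T` class `PromiseBQP` and `TM2` reductions
`FP`. This file decomposes it along the printed proof of S. Aaronson, A. Ambainis, *Forrelation*,
SIAM J. Comput. 47 (2018) = arXiv:1411.5729 (held; page numbers are those of the arXiv version),
§3.2 and §6, proving the linear-algebraic content and vendoring the complexity-theoretic shells
as named facts with the paper's numbering:

* **§3.2, p. 11 (PROVED, `forrelationCircuit_apply_zero_zero`)**: "`α_{0⋯0}` is precisely the
  quantity `Φ_{f₁,…,f_k}`" — the `k`-fold forrelation `kForrelationValue f` is the `⟨0ⁿ|·|0ⁿ⟩`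
  entry of the circuit of Fig. 2, `H^{⊗n} U_{f_k} H^{⊗n} ⋯ H^{⊗n} U_{f₁} H^{⊗n}`
  (`forrelationCircuit`, built from the library's closed form `hGateAll` of `H^{⊗n}` and the
  `±1` phase oracles `phaseLayer`); the whole first column is computed (`forrelationCircuit_apply_zero`,
  a path-sum induction on `k`). Consequences: the circuit is unitary
  (`forrelationCircuit_mem_unitaryGroup`) and **`|Φ| ≤ 1`** (§1.1.3, p. 5: "It is not hard to
  show", PROVED as `abs_kForrelationValue_le_one`).
* **§6, proof of Thm. 25, p. 27 (PROVED)**: the Hadamard gadget — the printed `4 × 4` identity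
  `(H^{⊗2}·CSIGN)³ = SWAP` (`hadamardTwo_mul_csignTwo_pow_three`), hence
  `H^{⊗2} C H^{⊗2} C H^{⊗2} C H^{⊗2} = S·H^{⊗2}` versus `H^{⊗2} I H^{⊗2} I H^{⊗2} I H^{⊗2} = I`
  (`hadamard_gadget`, `hadamard_gadget_identity`), and the same identity for the library's
  register-indexed matrices (`hadamard_gadget_qReg`; `forrelationCircuit_csign_three`: the
  Fig. 2 circuit with `f₁ = f₂ = f₃ = (-1)^{z₀z₁}` on two qubits *is* `SWAP · H^{⊗2}`).
* **§6, p. 26 (definitions)**: the gate set `{H, CCSIGN}` (`hCCSign`, in the library's `QGateSet`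
  format; its circuits have real matrices, `isRealMatrix_toMatrix`, and are unitary,
  `hCCSign_isUnitary`), the transition amplitude `A_Q = ⟨0ⁿ|Q|0ⁿ⟩` (`transitionAmplitude`,
  `|A_Q| ≤ 1` proved) and the promise problem **QSIM** (`qSimProblem`: `A_Q ≥ 3/5` vs `|A_Q| ≤ 1/100`,
  instances encoded with the library's `QCircuit.encode`; disjointness proved).
* **Named facts (not discharged; each is a `TM2`-level statement)**: Lemma 24 in its two halves
  (`AaronsonAmbainis2018_lemma24_mem`: QSIM `∈ PromiseBQP`; `AaronsonAmbainis2018_lemma24_hard`: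
  QSIM is `PromiseBQP`-hard, after Shi 2003), Theorem 25 as the Karp reduction QSIM `≤ₚ`
  explicit `k`-fold Forrelation (`AaronsonAmbainis2018_thm25`), membership of explicit `k`-fold
  Forrelation (`AaronsonAmbainis2018_kForrelation_mem`, p. 26 via Prop. 6). The amplitude form
  of Theorem 25 (for every `{H, CCSIGN}` circuit `Q`, functions `f₁,…,f_k` of the shape
  `IsFewBitProduct` with `Φ_{f₁,…,f_k} = A_Q`) is deliberately NOT vendored in its printed form
  ("`f₁,…,f_k : {0,1}^{n+1} → {±1}`, `k = O(m)`"), which over-claims: all Forrelation values on an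
  even number `n + 1` of bits lie in `ℤ[1/2]` (the prefactor `2^{-(k+1)(n+1)/2}` is then rational),
  whereas `A_Q ∈ 2^{-h/2}ℤ` for a circuit with `h` Hadamard gates can be irrational when `h` is
  odd (e.g. `n = 1`, `Q = H`: `A_Q = 1/√2`); the printed bookkeeping leaves the dummy qubit in the
  state `H|0⟩` when `h` is odd. With the dummy un-Hadamarded by one more bare Hadamard layer
  (possible when `n` is even) or with a second dummy qubit (`n` odd), `n + 2` bits and
  `k = O(m + n)` always suffice; that corrected linear-algebraic statement is the subject of a
  separate discharge, and only its shape predicate `IsFewBitProduct` is set up here.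
* **Assembly (PROVED, `aaronson_ambainis_kForrelation_complete_of_steps`)**: membership, Lemma 24
  (hardness), Theorem 25 and transitivity of promise reductions
  (`PromiseProblem.PolyTimeReducible.trans`, a named fact of `Promise.lean`) imply
  `aaronson_ambainis_kForrelation_complete`.

## Design choices

* Matrices are indexed by the library's registers `QReg n = Fin n → Bool` and valued in `ℂ`
  (as `hGateAll`, `hGate`, `QCircuit.toMatrix`); the real quantities `Φ`, `A_Q` are compared after
  the coercion `ℝ → ℂ` (`forrelationCircuit_apply_zero_zero`, `transitionAmplitude_coe`).
* `forrelationCircuit` recurses on `k` by peeling the *last* function (`Fin.init`, `Fin.last`),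
  matching the matrix order (first gate rightmost); the index-`0` convention of
  `kForrelationValue` (no twist in front of `f₀`) is absorbed by the boundary twist `lastTwist`.
* The gadget is first computed on `Fin 4` (the printed matrices, basis order `00,01,10,11`) by
  `fin_cases`/`simp`/`norm_num`, then transported to `QReg 2` along the explicit bijection
  `qRegTwoEquiv` with `Matrix.reindexRingEquiv`.
* QSIM instances are pairs `(n, Q)` with `Q : QCircuit hCCSign n` in the library's circuit syntax;
  that syntax has oracle gates, so the promise additionally asks `Q.IsOracleFree` (AA's circuits
  are plain `{H, CCSIGN}` circuits). `A_Q` is rendered as the real part of the `⟨0ⁿ|Q|0ⁿ⟩` entry,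
  which is proved real.
* Lemma 24's hardness is rendered, like every hardness statement of this library, with Karp
  (many-one) reductions of promise problems (`PromiseProblem.PolyTimeReducible`, Goldreich 2006,
  Def. 1.4); the printed sketch's treatment of a negative `A_Q` ("running both `Q` and `-Q`") is a
  two-query step which the standard uncomputation (acceptance probability as a nonnegative
  amplitude) avoids — recorded here, not claimed beyond the cite.
* Mathlib: `Matrix.unitaryGroup`, `entry_norm_bound_of_unitary` (entries of unitaries have norm
  `≤ 1`), `Matrix.reindexRingEquiv`, `Fin.snocEquiv`, `!![…]` notation. From the tree:
  `kForrelationValue`, `twist`, `signOf`, `kForrelationProblem` (`Forrelation.lean`), `hGateAll`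
  and its unitarity (`SamplingProblems.lean`), `QCircuit`, `placeGate`, `hGate`, `cz` (the CSIGN
  gate, `QubitRegister.lean`), `PromiseBQP`, `QCircuit.toMatrix_mem_unitaryGroup_holds`
  (`QuantumCircuitProofs.lean`).

## References

* S. Aaronson, A. Ambainis, *Forrelation: a problem that optimally separates quantum from
  classical computing*, SIAM J. Comput. 47 (2018) 982–1038; arXiv:1411.5729: §1.1.3 (p. 5),
  §3.2 with Prop. 6 (p. 11), §6 with Lemma 24 (p. 26), Thm. 25 (p. 27), Thm. 26 (pp. 27–28).
* Y. Shi, *Both Toffoli and controlled-NOT need little help to do universal quantum computing*,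
  Quantum Inf. Comput. 3 (2003) (`{H, Toffoli}` is universal).
* O. Goldreich, *On promise problems: a survey*, 2006, Def. 1.4 (Karp reductions of promise problems).
* M. A. Nielsen, I. L. Chuang, *Quantum Computation and Quantum Information*, CUP 2010, §1.4.4
  eq. (1.50) (`H^{⊗n}`).
-/

noncomputable section

namespace Literature.Computability.QuantumComplexity

open Matrix _root_.Computability Complexity Cryptography Finset

variable {n k : ℕ}

/-! ### The Forrelation circuit (AA Fig. 2) and `Φ` as a transition amplitude (§3.2) -/

/-- The phase oracle `U_f : |x⟩ ↦ f(x)|x⟩` of a Boolean function read in `{±1}`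
(`f(x) = (-1)^{C(x)}`, `signOf`), as a diagonal `2ⁿ × 2ⁿ` matrix.
[cite: AaronsonAmbainis2018, §3.1 and §3.2] -/
def phaseLayer (f : (Fin n → Bool) → Bool) : Matrix (QReg n) (QReg n) ℂ :=
  Matrix.diagonal fun x => ((signOf (f x) : ℝ) : ℂ)

/-- The quantum circuit of AA Fig. 2 for `k` Boolean functions `f₀, …, f_{k-1}` on `n` bits, as a
unitary matrix: `H^{⊗n} · U_{f_{k-1}} · H^{⊗n} ⋯ H^{⊗n} · U_{f₀} · H^{⊗n}` (the first gate applied,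
`H^{⊗n}`, is the rightmost factor; `H^{⊗n}` is the library's closed form `hGateAll`). Defined by
recursion on `k`, peeling off the last function. [cite: AaronsonAmbainis2018, §3.2 (Fig. 2)] -/
def forrelationCircuit : (k : ℕ) → (Fin k → (Fin n → Bool) → Bool) → Matrix (QReg n) (QReg n) ℂ
  | 0, _ => hGateAll n
  | k + 1, f => hGateAll n * phaseLayer (f (Fin.last k)) * forrelationCircuit k (Fin.init f)

/-- The summand of the twisted sum defining `Φ_{f₀,…,f_{k-1}}`:
`f₀(x₀) ∏_{0<i<k} (-1)^{x_{i-1}·x_i} f_i(x_i)` (so that `kForrelationValue f = 2^{-(k+1)n/2} ∑ₓ pathWeight f x`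
by definition, `kForrelationValue_eq`). [cite: AaronsonAmbainis2018, §1.1.3 and §3.2] -/
def pathWeight (f : Fin k → (Fin n → Bool) → Bool) (x : Fin k → (Fin n → Bool)) : ℝ :=
  ∏ i : Fin k, signOf (f i (x i)) *
    (if h : (i : ℕ) = 0 then 1 else twist (x ⟨(i : ℕ) - 1, by omega⟩) (x i))

/-- The boundary twist `(-1)^{x_{k-1}·y}` against an output label `y` (`1` when `k = 0`), used
to describe a whole column of the Forrelation circuit. [cite: AaronsonAmbainis2018, §3.2] -/
def lastTwist (k : ℕ) (x : Fin k → (Fin n → Bool)) (y : Fin n → Bool) : ℝ :=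
  if h : k = 0 then 1 else twist (x ⟨k - 1, by omega⟩) y

/-- `kForrelationValue` is the normalised sum of the path weights (definitional).
[cite: AaronsonAmbainis2018, §1.1.3] -/
theorem kForrelationValue_eq (f : Fin k → (Fin n → Bool) → Bool) :
    kForrelationValue f = (Real.sqrt (2 ^ ((k + 1) * n)))⁻¹ * ∑ x, pathWeight f x :=
  rfl

/-- The twist against the all-zero string is `1` (`x · 0 = 0`). [cite: AaronsonAmbainis2018, §3.2] -/
@[simp] theorem twist_zero_right (x : Fin n → Bool) : twist x (fun _ => false) = 1 := by
  simp [twist]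

/-- The boundary twist against the all-zero output is `1`. [cite: AaronsonAmbainis2018, §3.2] -/
@[simp] theorem lastTwist_zero_right (k : ℕ) (x : Fin k → (Fin n → Bool)) :
    lastTwist k x (fun _ => false) = 1 := by
  unfold lastTwist
  split_ifs <;> simp

/-- The boundary twist of a `(k+1)`-tuple is the twist of its last entry.
[cite: AaronsonAmbainis2018, §3.2] -/
theorem lastTwist_succ (x : Fin (k + 1) → (Fin n → Bool)) (y : Fin n → Bool) :
    lastTwist (k + 1) x y = twist (x (Fin.last k)) y := by
  unfold lastTwist
  rw [dif_neg (Nat.succ_ne_zero k)]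
  congr 2

/-- Peeling the last function off the path weight:
`w(f, x) = w(init f, init x) · f_{k}(x_k) · (-1)^{x_{k-1}·x_k}`. [cite: AaronsonAmbainis2018, §3.2] -/
theorem pathWeight_succ (f : Fin (k + 1) → (Fin n → Bool) → Bool) (x : Fin (k + 1) → (Fin n → Bool)) :
    pathWeight f x = pathWeight (Fin.init f) (Fin.init x) *
      (signOf (f (Fin.last k) (x (Fin.last k))) * lastTwist k (Fin.init x) (x (Fin.last k))) := by
  unfold pathWeight
  rw [Fin.prod_univ_castSucc]
  congr 1

/-- Entries of `H^{⊗n}` through the library's `twist`: `⟨x|H^{⊗n}|y⟩ = 2^{-n/2} (-1)^{x·y}`.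
[cite: NielsenChuang2010, §1.4.4 eq. (1.50)] -/
theorem hGateAll_apply_eq_twist (x y : QReg n) :
    hGateAll n x y = ((Real.sqrt 2 : ℂ)⁻¹) ^ n * (twist x y : ℂ) := by
  rw [hGateAll, Matrix.of_apply, neg_one_pow_card_filter_and]
  congr 1
  unfold twist
  push_cast
  refine Finset.prod_congr rfl fun i _ => ?_
  cases hx : x i <;> cases hy : y i <;> simp

/-- Sums over `(k+1)`-tuples split into the last entry and the initial `k`-tuple (`Fin.snocEquiv`).
[folklore] -/
theorem sum_tuple_succ {α M : Type*} [Fintype α] [AddCommMonoid M] (F : (Fin (k + 1) → α) → M) :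
    ∑ x : Fin (k + 1) → α, F x = ∑ z : α, ∑ x' : Fin k → α, F (Fin.snoc x' z) := by
  rw [← (Fin.snocEquiv fun _ => α).sum_comp, Fintype.sum_prod_type]
  rfl

/-- **A column of the Forrelation circuit.** For every output label `y`,
`⟨y| H^{⊗n} U_{f_{k-1}} ⋯ U_{f₀} H^{⊗n} |0ⁿ⟩ = 2^{-(k+1)n/2} ∑ₓ w(f, x) (-1)^{x_{k-1}·y}`
(path-sum expansion of the matrix product; induction on `k`). [cite: AaronsonAmbainis2018, §3.2] -/
theorem forrelationCircuit_apply_zero (k : ℕ) (f : Fin k → (Fin n → Bool) → Bool) (y : QReg n) :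
    forrelationCircuit k f y (fun _ => false) =
      ((Real.sqrt 2 : ℂ)⁻¹) ^ ((k + 1) * n) *
        ∑ x : Fin k → (Fin n → Bool), ((pathWeight f x * lastTwist k x y : ℝ) : ℂ) := by
  induction k generalizing y with
  | zero =>
    simp [forrelationCircuit, hGateAll_apply_eq_twist, pathWeight, lastTwist]
  | succ k ih =>
    rw [forrelationCircuit, Matrix.mul_apply, sum_tuple_succ]
    simp only [phaseLayer, Matrix.mul_diagonal, ih, hGateAll_apply_eq_twist, pathWeight_succ,
      Fin.init_snoc, Fin.snoc_last, lastTwist_succ]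
    rw [show (k + 1 + 1) * n = n + (k + 1) * n by ring, pow_add, Finset.mul_sum]
    refine Finset.sum_congr rfl fun z _ => ?_
    rw [Finset.mul_sum, Finset.mul_sum, Finset.mul_sum]
    refine Finset.sum_congr rfl fun x' _ => ?_
    rw [twist_comm z y]
    push_cast
    ring

/-- `√(2^m) = (√2)^m`. [folklore] -/
theorem sqrt_two_pow (m : ℕ) : Real.sqrt (2 ^ m) = Real.sqrt 2 ^ m := by
  rw [Real.sqrt_eq_iff_eq_sq (by positivity) (by positivity), ← pow_mul, mul_comm, pow_mul,
    Real.sq_sqrt (by norm_num : (0:ℝ) ≤ 2)]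

/-- **`Φ` is a transition amplitude (Aaronson–Ambainis, §3.2).** "Observe that `α_{0⋯0}` is
precisely the quantity `Φ_{f₁,…,f_k}`": the amplitude with which the circuit of Fig. 2
(`H^{⊗n}`, query `f₁`, `H^{⊗n}`, …, query `f_k`, `H^{⊗n}`, started on `|0ⁿ⟩`) returns to `|0ⁿ⟩`
equals the `k`-fold forrelation. [cite: AaronsonAmbainis2018, §3.2 (p. 11)] -/
theorem forrelationCircuit_apply_zero_zero (f : Fin k → (Fin n → Bool) → Bool) :
    forrelationCircuit k f (fun _ => false) (fun _ => false) = (kForrelationValue f : ℂ) := by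
  rw [forrelationCircuit_apply_zero, kForrelationValue_eq, sqrt_two_pow]
  simp only [lastTwist_zero_right, mul_one]
  push_cast
  rw [inv_pow]

/-- The phase oracle `U_f` is unitary (diagonal with entries `±1`).
[cite: AaronsonAmbainis2018, §3.1] -/
theorem phaseLayer_mem_unitaryGroup (f : (Fin n → Bool) → Bool) :
    phaseLayer f ∈ Matrix.unitaryGroup (QReg n) ℂ := by
  rw [Matrix.mem_unitaryGroup_iff, phaseLayer, Matrix.star_eq_conjTranspose,
    Matrix.diagonal_conjTranspose, Matrix.diagonal_mul_diagonal, ← Matrix.diagonal_one]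
  congr 1
  funext x
  cases h : f x <;> simp [signOf, h]

/-- The Forrelation circuit is unitary (a product of `H^{⊗n}` layers and phase oracles).
[cite: AaronsonAmbainis2018, §3.2] -/
theorem forrelationCircuit_mem_unitaryGroup (k : ℕ) (f : Fin k → (Fin n → Bool) → Bool) :
    forrelationCircuit k f ∈ Matrix.unitaryGroup (QReg n) ℂ := by
  induction k with
  | zero => exact hGateAll_mem_unitaryGroup_holds n
  | succ k ih =>
    exact Submonoid.mul_mem _ (Submonoid.mul_mem _ (hGateAll_mem_unitaryGroup_holds n)
      (phaseLayer_mem_unitaryGroup _)) (ih _)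

/-- **`|Φ_{f₁,…,f_k}| ≤ 1` (Aaronson–Ambainis, §1.1.3: "It is not hard to show that
`|Φ_{f₁,…,f_k}| ≤ 1`").** Proof: `Φ` is an entry of a unitary matrix
(`forrelationCircuit_apply_zero_zero`, `entry_norm_bound_of_unitary`).
[cite: AaronsonAmbainis2018, §1.1.3 (p. 5)] -/
theorem abs_kForrelationValue_le_one (f : Fin k → (Fin n → Bool) → Bool) :
    |kForrelationValue f| ≤ 1 := by
  have h := entry_norm_bound_of_unitary (forrelationCircuit_mem_unitaryGroup k f)
    (fun _ => false) (fun _ => false)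
  rwa [forrelationCircuit_apply_zero_zero, Complex.norm_real, Real.norm_eq_abs] at h

/-- In particular `|Φ| ≤ 1` for the value of every explicit instance. [cite: AaronsonAmbainis2018, §1.1.3 (p. 5)] -/
theorem KForrelationInstance.abs_value_le_one (I : KForrelationInstance) : |I.value| ≤ 1 :=
  abs_kForrelationValue_le_one _

/-! ### The Hadamard gadget of Theorem 25

The `4 × 4` identity printed in the proof of Theorem 25 (p. 27): with `H^{⊗2} = ½ (±1)`-matrix,
`C = CSIGN = diag(1,1,1,-1)` and `S = SWAP`, `(H^{⊗2} C)³ = S`, hence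
`H^{⊗2} C H^{⊗2} C H^{⊗2} C H^{⊗2} = S H^{⊗2}` while `H^{⊗2} I H^{⊗2} I H^{⊗2} I H^{⊗2} = I`:
choosing `C` for the three inner phase layers Hadamards the two qubits (and swaps them),
choosing the identity does nothing. Basis order `|00⟩, |01⟩, |10⟩, |11⟩`. -/

/-- `H^{⊗2}` on two qubits as the explicit `4 × 4` matrix `½ [[1,1,1,1],[1,-1,1,-1],[1,1,-1,-1],[1,-1,-1,1]]`
(basis order `00, 01, 10, 11`). [cite: AaronsonAmbainis2018, §6 (proof of Thm. 25, p. 27)] -/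
def hadamardTwo : Matrix (Fin 4) (Fin 4) ℂ :=
  (2 : ℂ)⁻¹ • !![1, 1, 1, 1; 1, -1, 1, -1; 1, 1, -1, -1; 1, -1, -1, 1]

/-- The controlled-sign gate `CSIGN = diag(1, 1, 1, -1)` (`|x,y⟩ ↦ (-1)^{xy}|x,y⟩`).
[cite: AaronsonAmbainis2018, §6 (proof of Thm. 25, p. 27)] -/
def csignTwo : Matrix (Fin 4) (Fin 4) ℂ :=
  !![1, 0, 0, 0; 0, 1, 0, 0; 0, 0, 1, 0; 0, 0, 0, -1]

/-- The two-qubit `SWAP` gate `|x,y⟩ ↦ |y,x⟩`. [cite: AaronsonAmbainis2018, §6 (proof of Thm. 25, p. 27)] -/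
def swapTwo : Matrix (Fin 4) (Fin 4) ℂ :=
  !![1, 0, 0, 0; 0, 0, 1, 0; 0, 1, 0, 0; 0, 0, 0, 1]

/-- `H^{⊗2}` is an involution: `H^{⊗2} H^{⊗2} = I`. [cite: AaronsonAmbainis2018, §6 (p. 26, "H² is the identity")] -/
theorem hadamardTwo_mul_self : hadamardTwo * hadamardTwo = 1 := by
  ext i j
  fin_cases i <;> fin_cases j <;> simp [hadamardTwo, Matrix.mul_apply, Fin.sum_univ_four] <;> norm_num

/-- `H^{⊗2} · CSIGN`, the repeated block of the gadget, as an explicit matrix. [cite: AaronsonAmbainis2018, §6 (proof of Thm. 25, p. 27)] -/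
theorem hadamardTwo_mul_csignTwo :
    hadamardTwo * csignTwo = (2 : ℂ)⁻¹ • !![1, 1, 1, -1; 1, -1, 1, 1; 1, 1, -1, 1; 1, -1, -1, -1] := by
  ext i j
  fin_cases i <;> fin_cases j <;> simp [hadamardTwo, csignTwo, Matrix.mul_apply, Fin.sum_univ_four]

/-- The square of the gadget block, `(H^{⊗2} · CSIGN)²`, as an explicit matrix.
[cite: AaronsonAmbainis2018, §6 (proof of Thm. 25, p. 27)] -/
theorem hadamardTwo_mul_csignTwo_mul_self :
    hadamardTwo * csignTwo * (hadamardTwo * csignTwo) =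
      (2 : ℂ)⁻¹ • !![1, 1, 1, 1; 1, 1, -1, -1; 1, -1, 1, -1; -1, 1, 1, -1] := by
  rw [hadamardTwo_mul_csignTwo]
  ext i j
  fin_cases i <;> fin_cases j <;> simp [Matrix.mul_apply, Fin.sum_univ_four] <;> norm_num

/-- **The gadget identity (Aaronson–Ambainis, proof of Thm. 25):** `(H^{⊗2} · CSIGN)³ = SWAP`,
i.e. the printed `4 × 4` identity `(½ [[1,1,1,1],[1,-1,1,-1],[1,1,-1,-1],[1,-1,-1,1]] · diag(1,1,1,-1))³ =
[[1,0,0,0],[0,0,1,0],[0,1,0,0],[0,0,0,1]]`. [cite: AaronsonAmbainis2018, §6 (proof of Thm. 25, p. 27)] -/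
theorem hadamardTwo_mul_csignTwo_pow_three : (hadamardTwo * csignTwo) ^ 3 = swapTwo := by
  rw [pow_three, hadamardTwo_mul_csignTwo_mul_self, hadamardTwo_mul_csignTwo]
  ext i j
  fin_cases i <;> fin_cases j <;> simp [swapTwo, Matrix.mul_apply, Fin.sum_univ_four] <;> norm_num

/-- The gadget with the sandwiching Hadamard layers written out:
`H^{⊗2} C H^{⊗2} C H^{⊗2} C H^{⊗2} = S · H^{⊗2}` — three CSIGN phase layers between the automatic
Hadamard layers Hadamard both qubits (and swap them). [cite: AaronsonAmbainis2018, §6 (proof of Thm. 25, p. 27)] -/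
theorem hadamard_gadget :
    hadamardTwo * csignTwo * hadamardTwo * csignTwo * hadamardTwo * csignTwo * hadamardTwo =
      swapTwo * hadamardTwo := by
  rw [← hadamardTwo_mul_csignTwo_pow_three, pow_three]
  simp only [mul_assoc]

/-- Contrast: with the identity in the inner layers the Hadamards cancel,
`H^{⊗2} I H^{⊗2} I H^{⊗2} I H^{⊗2} = I`. [cite: AaronsonAmbainis2018, §6 (proof of Thm. 25, p. 27)] -/
theorem hadamard_gadget_identity :
    hadamardTwo * 1 * hadamardTwo * 1 * hadamardTwo * 1 * hadamardTwo = 1 := by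
  simp only [mul_one, hadamardTwo_mul_self, one_mul]

/-! ### The gadget on a two-qubit register

The same identity for the library's register-indexed matrices (`QReg 2 = Fin 2 → Bool`), i.e. for
`hGateAll 2` and the library's controlled-`Z` gate `cz` (AA's CSIGN; it *is* the phase layer
`phaseLayer (z₀ ∧ z₁)`, `phaseLayer_and_eq_cz`): transported from the `Fin 4` computation along
the basis bijection `|x₀ x₁⟩ ↦ 2x₀ + x₁`. In particular the Forrelation circuit of Fig. 2 with
the three functions `f₁ = f₂ = f₃ = (-1)^{z₀ z₁}` *is* `SWAP · H^{⊗2}`. -/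

/-- AA's CSIGN on a two-qubit register, i.e. the phase layer `U_f` for `f = (-1)^{z₀ z₁}`, is the
library's controlled-`Z` gate `cz` (`QubitRegister.lean`).
[cite: AaronsonAmbainis2018, §6 (proof of Thm. 25, p. 27: "we can implement a CSIGN on a and b as U_{f_i}")] -/
theorem phaseLayer_and_eq_cz : phaseLayer (fun z : Fin 2 → Bool => z 0 && z 1) = cz := by
  ext x y
  by_cases h : x = y
  · subst h
    simp only [phaseLayer, Matrix.diagonal_apply_eq, cz, Matrix.of_apply, if_true, signOf,
      Bool.and_eq_true]
    split_ifs <;> simp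
  · simp [phaseLayer, cz, h]

/-- The SWAP gate on a two-qubit register: `|x₀, x₁⟩ ↦ |x₁, x₀⟩`. [cite: AaronsonAmbainis2018, §6 (proof of Thm. 25, p. 27)] -/
def swapLayer : Matrix (QReg 2) (QReg 2) ℂ :=
  Matrix.of fun x y => if x 0 = y 1 ∧ x 1 = y 0 then 1 else 0

/-- The basis bijection `QReg 2 ≃ Fin 4`, `|x₀ x₁⟩ ↦ 2x₀ + x₁` (order `00, 01, 10, 11`). [folklore] -/
def qRegTwoEquiv : QReg 2 ≃ Fin 4 where
  toFun x := ⟨2 * (x 0).toNat + (x 1).toNat, by cases x 0 <;> cases x 1 <;> decide⟩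
  invFun i := ![decide (2 ≤ (i : ℕ)), decide ((i : ℕ) % 2 = 1)]
  left_inv := by decide
  right_inv := by decide

/-- `(√2)² = 2` in `ℂ`. [folklore] -/
theorem sqrt_two_sq_complex : ((Real.sqrt 2 : ℂ)) ^ 2 = 2 := by
  rw [← Complex.ofReal_pow, Real.sq_sqrt (by norm_num : (0:ℝ) ≤ 2)]
  push_cast
  rfl

/-- `H^{⊗2}` in the basis order `00, 01, 10, 11` is the explicit matrix `hadamardTwo`.
[cite: NielsenChuang2010, §1.4.4 eq. (1.50)] -/
theorem reindex_hGateAll_two :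
    Matrix.reindex qRegTwoEquiv qRegTwoEquiv (hGateAll 2) = hadamardTwo := by
  ext i j
  fin_cases i <;> fin_cases j <;>
    simp [qRegTwoEquiv, hGateAll_apply_eq_twist, twist, Fin.prod_univ_two, sqrt_two_sq_complex,
      hadamardTwo]

/-- The controlled-`Z` gate (CSIGN) in the basis order `00, 01, 10, 11` is `diag(1,1,1,-1)`.
[cite: AaronsonAmbainis2018, §6 (proof of Thm. 25, p. 27)] -/
theorem reindex_cz :
    Matrix.reindex qRegTwoEquiv qRegTwoEquiv cz = csignTwo := by
  ext i j
  fin_cases i <;> fin_cases j <;>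
    simp [qRegTwoEquiv, cz, funext_iff, Fin.forall_fin_two, csignTwo]

/-- The SWAP gate in the basis order `00, 01, 10, 11` is the explicit matrix `swapTwo`.
[cite: AaronsonAmbainis2018, §6 (proof of Thm. 25, p. 27)] -/
theorem reindex_swapLayer :
    Matrix.reindex qRegTwoEquiv qRegTwoEquiv swapLayer = swapTwo := by
  ext i j
  fin_cases i <;> fin_cases j <;> simp [qRegTwoEquiv, swapLayer, swapTwo]

/-- **The gadget on a two-qubit register**: three CSIGN (`cz`) layers between the four Hadamard
layers of the Forrelation circuit give `SWAP · H^{⊗2}`,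
`H^{⊗2} C H^{⊗2} C H^{⊗2} C H^{⊗2} = S · H^{⊗2}` (for `hGateAll 2`, `cz`, `swapLayer`).
[cite: AaronsonAmbainis2018, §6 (proof of Thm. 25, p. 27)] -/
theorem hadamard_gadget_qReg :
    hGateAll 2 * cz * hGateAll 2 * cz * hGateAll 2 * cz * hGateAll 2 = swapLayer * hGateAll 2 := by
  apply (Matrix.reindexRingEquiv ℂ qRegTwoEquiv).injective
  simp only [map_mul, Matrix.coe_reindexRingEquiv, reindex_hGateAll_two, reindex_cz,
    reindex_swapLayer]
  exact hadamard_gadget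

/-- The same, phrased with the Forrelation circuit of Fig. 2: for `n = 2`, `k = 3` and
`f₁ = f₂ = f₃ = (-1)^{z₀ z₁}`, the circuit `H^{⊗2} U_{f₃} H^{⊗2} U_{f₂} H^{⊗2} U_{f₁} H^{⊗2}` equals
`SWAP · H^{⊗2}` — the two qubits are Hadamarded (once) and swapped.
[cite: AaronsonAmbainis2018, §6 (proof of Thm. 25, p. 27)] -/
theorem forrelationCircuit_csign_three :
    forrelationCircuit 3 (fun _ => fun z : Fin 2 → Bool => z 0 && z 1) = swapLayer * hGateAll 2 := by
  rw [← hadamard_gadget_qReg, ← phaseLayer_and_eq_cz]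
  simp only [forrelationCircuit, mul_assoc]
  rfl

/-! ### Real matrices (the `{H, CCSIGN}` circuits of §6 have real amplitudes) -/

/-- A complex square matrix is *real* if every entry has vanishing imaginary part. [folklore] -/
def IsRealMatrix {ι : Type*} (M : Matrix ι ι ℂ) : Prop :=
  ∀ x y, (M x y).im = 0

/-- Products of real matrices are real. [folklore] -/
theorem IsRealMatrix.mul {ι : Type*} [Fintype ι] {M N : Matrix ι ι ℂ} (hM : IsRealMatrix M)
    (hN : IsRealMatrix N) : IsRealMatrix (M * N) := by
  intro x y
  rw [Matrix.mul_apply, Complex.im_sum]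
  exact Finset.sum_eq_zero fun a _ => by simp [Complex.mul_im, hM x a, hN a y]

/-- The identity matrix is real. [folklore] -/
theorem IsRealMatrix.one {ι : Type*} [DecidableEq ι] : IsRealMatrix (1 : Matrix ι ι ℂ) := by
  intro x y
  by_cases h : x = y <;> simp [Matrix.one_apply, h]

/-- Placing a real gate gives a real operator. [folklore] -/
theorem IsRealMatrix.placeGate {m N : ℕ} (e : Fin m ↪ Fin N) {U : Matrix (QReg m) (QReg m) ℂ}
    (hU : IsRealMatrix U) : IsRealMatrix (placeGate e U) := by
  intro x y
  rw [placeGate_apply]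
  split_ifs
  · exact hU _ _
  · rfl

/-- The Hadamard gate is real. [folklore] -/
theorem isRealMatrix_hGate : IsRealMatrix hGate := by
  intro x y
  simp only [hGate, Matrix.of_apply]
  split_ifs <;> simp

/-- The XOR oracle gate (a `0/1` matrix) is real. [folklore] -/
theorem isRealMatrix_oracleGate (A : Language Bool) (m : ℕ) : IsRealMatrix (oracleGate A m) := by
  intro x y
  simp only [oracleGate, Matrix.of_apply]
  split_ifs <;> simp

/-! ### `QSIM` over the gate set `{H, CCSIGN}` (Aaronson–Ambainis, §6) -/

/-- The gate symbols of the gate set `{H, CCSIGN}` of AA §6 (universal by Shi 2003: Toffoli is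
CCSIGN conjugated by Hadamards on the target). [cite: AaronsonAmbainis2018, §6 (p. 26)] -/
inductive HCCSignOp
  /-- The Hadamard gate. -/
  | H
  /-- The controlled-controlled-sign gate `|x,y,z⟩ ↦ (-1)^{xyz}|x,y,z⟩`. -/
  | CCSIGN
  deriving DecidableEq, Fintype, Inhabited

/-- `HCCSignOp` is encodable (via `Bool`), as needed for the Boolean encoding of circuits. [folklore] -/
instance : Encodable HCCSignOp := Encodable.ofEquiv Bool
  { toFun := fun g => match g with | .H => false | .CCSIGN => true
    invFun := fun b => match b with | false => .H | true => .CCSIGN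
    left_inv := fun g => by cases g <;> rfl
    right_inv := fun b => by cases b <;> rfl }

/-- The controlled-controlled-sign gate `CCSIGN : |x,y,z⟩ ↦ (-1)^{xyz} |x,y,z⟩` (`= CCZ`, the
Toffoli gate with its target conjugated by Hadamards). [cite: AaronsonAmbainis2018, §6 (p. 26)] -/
def ccsign : Matrix (QReg 3) (QReg 3) ℂ :=
  Matrix.diagonal fun x => if x 0 = true ∧ x 1 = true ∧ x 2 = true then -1 else 1

/-- `CCSIGN` is real. [folklore] -/
theorem isRealMatrix_ccsign : IsRealMatrix ccsign := by
  intro x y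
  by_cases h : x = y
  · subst h
    simp only [ccsign, Matrix.diagonal_apply_eq]
    split_ifs <;> simp
  · simp [ccsign, Matrix.diagonal_apply_ne _ h]

/-- The gate set `{H, CCSIGN}` (arities `1, 3`) of AA §6, in the library's `QGateSet` format.
[cite: AaronsonAmbainis2018, §6 (p. 26)] -/
def hCCSign : QGateSet where
  Op := HCCSignOp
  arity
    | .H => 1
    | .CCSIGN => 3
  mat
    | .H => hGate
    | .CCSIGN => ccsign

/-- The `Encodable` structure on the gate alphabet of `hCCSign` (transported from `HCCSignOp`, to
which `hCCSign.Op` is definitionally equal; cf. `instEncodableOpCliffordT`). [folklore] -/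
instance instEncodableOpHCCSign : Encodable hCCSign.Op := inferInstanceAs (Encodable HCCSignOp)

/-- Every placed gate of an `{H, CCSIGN}` circuit (oracle gates included) is a real matrix. [folklore] -/
theorem isRealMatrix_toMatrix_gate {N : ℕ} (A : Language Bool) (g : QGate hCCSign N) :
    IsRealMatrix (g.toMatrix A) := by
  rcases g with ⟨g, e⟩ | ⟨m, e⟩
  · rcases g with _ | _
    · exact IsRealMatrix.placeGate e isRealMatrix_hGate
    · exact IsRealMatrix.placeGate e isRealMatrix_ccsign
  · exact IsRealMatrix.placeGate e (isRealMatrix_oracleGate A m)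

/-- **Circuits over `{H, CCSIGN}` compute real matrices** (all gate entries lie in `ℤ[1/√2]`).
[cite: AaronsonAmbainis2018, §6 (p. 26)] -/
theorem isRealMatrix_toMatrix {N : ℕ} (A : Language Bool) (Q : QCircuit hCCSign N) :
    IsRealMatrix (Q.toMatrix A) := by
  obtain ⟨gs⟩ := Q
  induction gs with
  | nil => simpa using (IsRealMatrix.one : IsRealMatrix (1 : Matrix (QReg N) (QReg N) ℂ))
  | cons g gs ih =>
    rw [QCircuit.toMatrix_cons]
    exact ih.mul (isRealMatrix_toMatrix_gate A g)

/-- **The transition amplitude `A_Q := ⟨0ⁿ| Q |0ⁿ⟩`** of an `n`-qubit circuit `Q` over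
`{H, CCSIGN}` (oracle-free semantics `QCircuit.mat`), so that `A_Q²` is the probability that `Q`
returns the all-`0` state to itself. The matrix of `Q` is real (`isRealMatrix_toMatrix`), so
taking the real part loses nothing (`transitionAmplitude_coe`). [cite: AaronsonAmbainis2018, §6 (p. 26)] -/
def transitionAmplitude {N : ℕ} (Q : QCircuit hCCSign N) : ℝ :=
  (Q.mat (fun _ => false) (fun _ => false)).re

/-- `A_Q` *is* the `⟨0ⁿ|Q|0ⁿ⟩` entry (that entry is real). [cite: AaronsonAmbainis2018, §6 (p. 26)] -/
theorem transitionAmplitude_coe {N : ℕ} (Q : QCircuit hCCSign N) :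
    (transitionAmplitude Q : ℂ) = Q.mat (fun _ => false) (fun _ => false) :=
  Complex.ext rfl (by simpa using (isRealMatrix_toMatrix 0 Q _ _).symm)

/-- The Hadamard gate is the case `n = 1` of the closed form `H^{⊗n}`. [folklore] -/
theorem hGate_eq_hGateAll_one : hGate = hGateAll 1 := by
  ext x y
  exact (hGateAll_one_apply x y).symm

/-- `CCSIGN` is unitary (diagonal with entries `±1`). [cite: AaronsonAmbainis2018, §6 (p. 26)] -/
theorem ccsign_mem_unitaryGroup : ccsign ∈ Matrix.unitaryGroup (QReg 3) ℂ := by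
  rw [Matrix.mem_unitaryGroup_iff, ccsign, Matrix.star_eq_conjTranspose,
    Matrix.diagonal_conjTranspose, Matrix.diagonal_mul_diagonal, ← Matrix.diagonal_one]
  congr 1
  funext x
  dsimp only [Pi.star_apply]
  split_ifs <;> simp

/-- The gate set `{H, CCSIGN}` is unitary. [cite: AaronsonAmbainis2018, §6 (p. 26)] -/
theorem hCCSign_isUnitary : hCCSign.IsUnitary := by
  rintro (_ | _)
  · change hGate ∈ Matrix.unitaryGroup (QReg 1) ℂ
    rw [hGate_eq_hGateAll_one]
    exact hGateAll_mem_unitaryGroup_holds 1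
  · exact ccsign_mem_unitaryGroup

/-- `|A_Q| ≤ 1`: `A_Q` is an entry of a unitary matrix
(`QCircuit.toMatrix_mem_unitaryGroup_holds`). [cite: AaronsonAmbainis2018, §6 (p. 26)] -/
theorem abs_transitionAmplitude_le_one {N : ℕ} (Q : QCircuit hCCSign N) :
    |transitionAmplitude Q| ≤ 1 := by
  have h := entry_norm_bound_of_unitary
    (QCircuit.toMatrix_mem_unitaryGroup_holds hCCSign_isUnitary 0 Q) (fun _ => false) (fun _ => false)
  have hc : (transitionAmplitude Q : ℂ) = Q.toMatrix 0 (fun _ => false) (fun _ => false) :=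
    transitionAmplitude_coe Q
  rwa [← hc, Complex.norm_real, Real.norm_eq_abs] at h

/-- An instance of **QSIM** (AA §6): a number of qubits `n` and an `n`-qubit circuit over
`{H, CCSIGN}` (library syntax `QCircuit hCCSign n`; instances using the syntax's oracle gates are
outside the promise). [cite: AaronsonAmbainis2018, §6 (p. 26)] -/
structure QSimInstance where
  /-- Number of qubits. -/
  n : ℕ
  /-- The circuit. -/
  circuit : QCircuit hCCSign n

namespace QSimInstance

/-- The amplitude `A_Q = ⟨0ⁿ|Q|0ⁿ⟩` of an instance. [cite: AaronsonAmbainis2018, §6 (p. 26)] -/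
def amplitude (I : QSimInstance) : ℝ :=
  transitionAmplitude I.circuit

/-- Yes-instances of QSIM: (oracle-free) circuits with `A_Q ≥ 3/5`. [cite: AaronsonAmbainis2018, §6 (p. 26)] -/
def IsYes (I : QSimInstance) : Prop :=
  I.circuit.IsOracleFree ∧ 3 / 5 ≤ I.amplitude

/-- No-instances of QSIM: (oracle-free) circuits with `|A_Q| ≤ 1/100`. [cite: AaronsonAmbainis2018, §6 (p. 26)] -/
def IsNo (I : QSimInstance) : Prop :=
  I.circuit.IsOracleFree ∧ |I.amplitude| ≤ 1 / 100

/-- No instance is both yes and no (`1/100 < 3/5`). [cite: AaronsonAmbainis2018, §6 (p. 26)] -/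
theorem not_isNo_of_isYes {I : QSimInstance} (h : I.IsYes) : ¬ I.IsNo := by
  rintro ⟨-, hno⟩
  have h1 : I.amplitude ≤ 1 / 100 := (le_abs_self _).trans hno
  linarith [h.2]

/-- Boolean encoding of a QSIM instance: `⟨n, code of the circuit⟩` with `n` in binary and the
library's gate-list encoding `QCircuit.encode`. [cite: AaronsonAmbainis2018, §6 (p. 26)] -/
def encode (I : QSimInstance) : List Bool :=
  boolPair (encodeNat I.n) I.circuit.encode

/-- The encoding of QSIM instances is injective. [folklore] -/
theorem encode_injective : Function.Injective encode := by
  rintro ⟨n, Q⟩ ⟨n', Q'⟩ h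
  obtain ⟨h1, h2⟩ := boolPair_inj.1 h
  obtain rfl : n = n' := encodeNat_injective h1
  obtain rfl : Q = Q' := QCircuit.encode_injective h2
  rfl

end QSimInstance

/-- **QSIM** (AA §6) as a promise problem over `{0,1}`: given (the code of) an `n`-qubit circuit
`Q` over `{H, CCSIGN}`, decide whether `A_Q ≥ 3/5` (yes) or `|A_Q| ≤ 1/100` (no), promised one of
these holds. [cite: AaronsonAmbainis2018, §6 (p. 26)] -/
def qSimProblem : PromiseProblem :=
  ⟨QSimInstance.encode '' {I | I.IsYes}, QSimInstance.encode '' {I | I.IsNo}⟩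

/-- The code of an instance is a yes-instance of QSIM iff the instance is. [folklore] -/
@[simp] theorem encode_mem_qSimProblem_yes_iff (I : QSimInstance) :
    I.encode ∈ qSimProblem.yes ↔ I.IsYes :=
  QSimInstance.encode_injective.mem_set_image

/-- The code of an instance is a no-instance of QSIM iff the instance is. [folklore] -/
@[simp] theorem encode_mem_qSimProblem_no_iff (I : QSimInstance) :
    I.encode ∈ qSimProblem.no ↔ I.IsNo :=
  QSimInstance.encode_injective.mem_set_image

/-- QSIM is a genuine (disjoint) promise problem. [cite: AaronsonAmbainis2018, §6 (p. 26)] -/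
theorem qSimProblem_disjoint : qSimProblem.Disjoint := by
  refine Set.disjoint_left.2 ?_
  rintro w ⟨I, hI, rfl⟩ hno
  exact I.not_isNo_of_isYes hI ((encode_mem_qSimProblem_no_iff I).1 hno)

/-! ### The steps of §6 as named facts, and the assembly -/

/-- NAMED FACT (**AA Lemma 24, membership half**): QSIM is in `PromiseBQP` — simulate the given
`{H, CCSIGN}` circuit by a uniform Clifford+`T` family (CCSIGN `=` CCZ has an exact Clifford+`T`
circuit), measure, and amplify the `9/25` vs `10⁻⁴` gap in the probability of returning to `|0ⁿ⟩`.
[cite: AaronsonAmbainis2018, §6 Lemma 24] -/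
def AaronsonAmbainis2018_lemma24_mem : Prop :=
  qSimProblem ∈ PromiseBQP

/-- NAMED FACT (**AA Lemma 24, hardness half; "follows from Shi"**): QSIM is `PromiseBQP`-hard
under polynomial-time Karp reductions of promise problems: `{H, Toffoli}` (equivalently
`{H, CCSIGN}`) is universal (Shi 2003), circuits are modified by uncomputing so that acceptance is
returning to `|0ⁿ⟩`, and the gap is amplified to `3/5` vs `1/100`. Rendering note: the Karp
(many-one) form is this tree's convention for hardness (`ForrelationComplete.lean`,
`PromiseProblem.PolyTimeReducible`) and goes slightly beyond the printed sketch, which handles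
a negative `A_Q` by "running both `Q` and `-Q`" (a two-query reduction); with the uncomputed
circuit `A_Q` is an acceptance probability, hence nonnegative, and one query suffices.
[cite: AaronsonAmbainis2018, §6 Lemma 24] -/
def AaronsonAmbainis2018_lemma24_hard : Prop :=
  ∀ Q ∈ PromiseBQP, PromiseProblem.PolyTimeReducible Q qSimProblem

/-- NAMED FACT (**AA Theorem 25, the reduction**): QSIM Karp-reduces in polynomial time to
explicit `k`-fold Forrelation (`kForrelationProblem`; as printed the reduction lands in `k = O(m)`
for `m`-gate circuits, with every `fᵢ = (-1)^{C}` for `C` a product of at most `3` input bits, on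
`n + 1` bits — see the module docstring for the parity correction: `n + 2` bits and
`k = O(m + n)` in general, which does not affect polynomial-time reducibility). Together with
Lemma 24 this is the printed statement "explicit `k`-fold Forrelation, for `k = poly(n)`, is
`PromiseBQP`-hard". [cite: AaronsonAmbainis2018, §6 Thm. 25] -/
def AaronsonAmbainis2018_thm25 : Prop :=
  PromiseProblem.PolyTimeReducible qSimProblem kForrelationProblem

/-- NAMED FACT (**AA §6, p. 26 with Prop. 6: explicit `k`-fold Forrelation is "clearly in
`PromiseBQP`"**): run the `⌈k/2⌉`-query (or the `k`-query, Fig. 2) Forrelation algorithm, each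
query to `fᵢ` answered by evaluating the given circuit `Cᵢ` reversibly, and amplify the error
`0.4` below `1/3`. [cite: AaronsonAmbainis2018, §6 (p. 26) and §3.2 Prop. 6] -/
def AaronsonAmbainis2018_kForrelation_mem : Prop :=
  kForrelationProblem ∈ PromiseBQP

/-- **Assembly of §6.** Membership (p. 26 via Prop. 6), `PromiseBQP`-hardness of QSIM
(Lemma 24), the reduction QSIM `≤ₚ` explicit `k`-fold Forrelation (Thm. 25) and transitivity of
Karp reductions of promise problems (`PromiseProblem.PolyTimeReducible.trans`, Goldreich 2006
Def. 1.4 — a named fact of `Promise.lean`) give the vendored completeness statement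
`aaronson_ambainis_kForrelation_complete`. [cite: AaronsonAmbainis2018, §6 (Lemma 24, Thm. 25)] -/
theorem aaronson_ambainis_kForrelation_complete_of_steps
    (hmem : AaronsonAmbainis2018_kForrelation_mem) (h24 : AaronsonAmbainis2018_lemma24_hard)
    (h25 : AaronsonAmbainis2018_thm25) (htrans : PromiseProblem.PolyTimeReducible.trans) :
    aaronson_ambainis_kForrelation_complete :=
  ⟨hmem, fun Q hQ => htrans (h24 Q hQ) h25⟩

/-- Conversely, completeness of explicit `k`-fold Forrelation and membership of QSIM in
`PromiseBQP` (Lemma 24) give back the reduction of Theorem 25. [cite: AaronsonAmbainis2018, §6 (Lemma 24, Thm. 25)] -/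
theorem AaronsonAmbainis2018_thm25_of_complete (h : aaronson_ambainis_kForrelation_complete)
    (h24 : AaronsonAmbainis2018_lemma24_mem) : AaronsonAmbainis2018_thm25 :=
  h.2 _ h24

/-! ### The shape of the functions produced by Theorem 25 -/

/-- `g = (-1)^{C}`-data of the shape produced by the reduction of Thm. 25: the `{0,1}`-valued `C`
is either identically `0` (so `f = 1`; `S = ∅`) or the product (conjunction) of the input bits in
a nonempty set `S` of at most `3` positions (`(-1)^{z_a z_b}`, `(-1)^{z_a z_b z_c}`; single bits
allowed). [cite: AaronsonAmbainis2018, §6 Thm. 25 ("C is a product of at most 3 input bits")] -/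
def IsFewBitProduct {m : ℕ} (g : (Fin m → Bool) → Bool) : Prop :=
  ∃ S : Finset (Fin m), S.card ≤ 3 ∧ ∀ z, (g z = true ↔ S.Nonempty ∧ ∀ a ∈ S, z a = true)

/-- The constant function `false` (`C = 0`, `f = (-1)^0 = 1`) has the required shape. [folklore] -/
theorem isFewBitProduct_const_false (m : ℕ) : IsFewBitProduct (fun _ : Fin m → Bool => false) :=
  ⟨∅, by simp, fun z => by simp⟩

end Literature.Computability.QuantumComplexity

end
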